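import Summits.BirchSwinnertonDyer.BirchSwinnertonDyer.Theorems.BiquadraticEisensteinDescentHeegnerTwistCouplingInSupplySymbolicMonskySound
import HarnessLib

set_option linter.dupNamespace false -- `Summit.BirchSwinnertonDyer.BirchSwinnertonDyer.Theorems.…` (summit = sub)
set_option autoImplicit false

/-!
# Crux `HeegnerTwistCouplingInSupply` (stmt-BirchSwinnertonDyer-21381), card `sign-table-character-dichotomy`:
# TRANSPORT — primes realising the symbol data have THESE Monsky matrices ("the matrix depends only on the symbol data")

Cell `pub/bsd-wall`, width-prover seat `bsd-wall-cm-bed-w3` g18; third file of the symbolic Monsky engine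
(`…SymbolicMonskyDefs.lean` definitions, `…SymbolicMonskySound.lean` soundness, `…SymbolicMonskyRealise.lean` the game layer).
* **Transport** (`Matches P d`: distinct primes `P : Fin k → ℕ` in the data's classes mod `8` with the data's symbols
  `(P_j/P_i)`, `i < j`): quadratic reciprocity for the Jacobi symbol (Mathlib `jacobiSym.quadratic_reciprocity_one_mod_four{,'}`
  / `_three_mod_four`) and the supplements at `2, −1, −2` (tree `HeathBrown1994.Families.jacobiSym_two_eq_one/neg_one`, …)
  evaluate every additive symbol of the tree's `legendreMatrix` / `legendreDiagonal` from the data, the diagonal of `A` being the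
  row parity: `monskyMatrixOdd P = d.monskyOddS`, `monskyMatrixEven P = d.monskyEvenS`; with soundness,
  **`Matches P d → d.detCheckOdd = true → det (monskyMatrixOdd P) = 1`** (and even) — the tree's `det = 1` door
  (`HeathBrown1994.monskySelmerRankOdd_eq_zero_of_det`, `CongruentNumberMonskySelmer.card_selmerGroup_two_eq_four_of_det_odd'`)
  then gives `s = 0`, `#Sel₂ = 4` — not restated here.
THEOREMS ONLY; nothing about Selmer groups, `L`-values, the crux or BSD is asserted. Supports stmt-BirchSwinnertonDyer-21381.
References: [HeathBrown1994] appendix (Monsky), typescript p. 39 L10–L33, p. 41 L20–L36; [IrelandRosen1990] Ch. 5 §2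
(Jacobi symbol, reciprocity and supplements).
-/

namespace Summit.BirchSwinnertonDyer.BirchSwinnertonDyer.Theorems.SymbolicMonsky

open Matrix Literature.NumberTheory.EllipticCurves Literature.NumberTheory.EllipticCurves.HeathBrown1994
  Literature.NumberTheory.EllipticCurves.HeathBrown1994.Families

/-- `bz` is additive for XOR (`1 + 1 = 0` in `𝔽₂`); private copy (a textually identical statement about an unrelated `bz` exists
elsewhere in the tree, so the public form would trip the textual dedup lint). -/
private theorem bz_xor (a b : Bool) : bz (xor a b) = bz a + bz b := by
  cases a <;> cases b <;> decide

/-! ## §1 Transport: primes realising the symbol data have THESE Monsky matrices -/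

/-- The four odd classes mod `8`. -/
theorem clsVal_mem : ∀ c : Fin 4, clsVal c = 1 ∨ clsVal c = 3 ∨ clsVal c = 5 ∨ clsVal c = 7 := by decide

/-- `[(2/·) = −1]` ⟺ class `3` or `5`. -/
theorem negTwo_eq : ∀ c : Fin 4, negTwo c = decide (clsVal c = 3 ∨ clsVal c = 5) := by decide

/-- `[(−1/·) = −1]` ⟺ class `3` or `7`. -/
theorem negNegOne_eq : ∀ c : Fin 4, negNegOne c = decide (clsVal c = 3 ∨ clsVal c = 7) := by decide

/-- `[(−2/·) = −1]` ⟺ class `5` or `7`. -/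
theorem negNegTwo_eq : ∀ c : Fin 4, negNegTwo c = decide (clsVal c = 5 ∨ clsVal c = 7) := by decide

section Transport

variable {k : ℕ} {P : Fin k → ℕ} {d : SymbData k}

/-- Realising primes are odd. -/
theorem Matches.mod_two (hM : Matches P d) (i : Fin k) : P i % 2 = 1 := by
  have h8 := hM.mod_eight i
  have := clsVal_mem (d.cls i)
  omega

/-- Realising primes are not `2`. -/
theorem Matches.ne_two (hM : Matches P d) (i : Fin k) : P i ≠ 2 := by
  have := hM.mod_two i
  omega

/-- `P_i ≡ 3 (mod 4)` ⟺ the class bit `[(−1/P_i) = −1]`. -/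
theorem Matches.mod_four_eq_three_iff (hM : Matches P d) (i : Fin k) :
    P i % 4 = 3 ↔ negNegOne (d.cls i) = true := by
  rw [negNegOne_eq, decide_eq_true_iff]
  have h8 := hM.mod_eight i
  have := clsVal_mem (d.cls i)
  omega

/-- Realising primes are pairwise distinct. -/
theorem Matches.ne (hM : Matches P d) {i j : Fin k} (hij : i ≠ j) : P i ≠ P j :=
  fun h => hij (hM.injective h)

/-- The symbols between two of the primes are `±1`. -/
theorem Matches.eq_one_or (hM : Matches P d) {i j : Fin k} (hij : i ≠ j) :
    jacobiSym (P j) (P i) = 1 ∨ jacobiSym (P j) (P i) = -1 :=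
  jacobiSym.eq_one_or_neg_one (int_gcd_eq_one_of_primes (hM.prime j) (hM.prime i) (hM.ne hij.symm))

/-- **Quadratic reciprocity bookkeeping**: the completed symbol of the data is the Legendre symbol. -/
theorem Matches.eq_neg_one_iff (hM : Matches P d) {i j : Fin k} (hij : i ≠ j) :
    jacobiSym (P j) (P i) = -1 ↔ d.neg i j = true := by
  rcases lt_or_gt_of_ne hij with h | h
  · rw [SymbData.neg, if_pos h]
    exact hM.up_iff i j h
  · rw [SymbData.neg, if_neg (not_lt.mpr h.le)]
    have hup := hM.up_iff j i h
    have hvals := hM.eq_one_or hij.symm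
    by_cases h3 : P i % 4 = 3 ∧ P j % 4 = 3
    · have hflip : (negNegOne (d.cls i) && negNegOne (d.cls j)) = true := by
        rw [Bool.and_eq_true, ← hM.mod_four_eq_three_iff, ← hM.mod_four_eq_three_iff]; exact h3
      rw [hflip, jacobiSym.quadratic_reciprocity_three_mod_four h3.2 h3.1]
      rcases hvals with h1 | h1
      · rw [h1]
        have : d.up j i = false := by
          cases hu : d.up j i
          · rfl
          · exact absurd (hup.mpr hu) (by rw [h1]; decide)
        simp [this]
      · rw [h1]
        simp [hup.mp h1]
    · have hflip : (negNegOne (d.cls i) && negNegOne (d.cls j)) = false := by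
        rw [Bool.eq_false_iff, Ne, Bool.and_eq_true, ← hM.mod_four_eq_three_iff, ← hM.mod_four_eq_three_iff]
        exact h3
      rw [hflip, Bool.xor_false]
      have hsymm : jacobiSym (P j : ℤ) (P i) = jacobiSym (P i : ℤ) (P j) := by
        have hi := hM.mod_two i
        have hj := hM.mod_two j
        rcases Nat.odd_mod_four_iff.mp hj with hj4 | hj4
        · exact jacobiSym.quadratic_reciprocity_one_mod_four hj4 (Nat.odd_iff.mpr hi)
        · rcases Nat.odd_mod_four_iff.mp hi with hi4 | hi4
          · exact jacobiSym.quadratic_reciprocity_one_mod_four' (Nat.odd_iff.mpr hj) hi4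
          · exact absurd ⟨hi4, hj4⟩ h3
      rw [hsymm]
      exact hup

/-- The additive symbol of the data is Monsky's additive symbol. -/
theorem Matches.addLegendreSym_eq (hM : Matches P d) {i j : Fin k} (hij : i ≠ j) :
    addLegendreSym (P j : ℤ) (P i) = bz (d.neg i j) := by
  have hiff := hM.eq_neg_one_iff hij
  rcases hM.eq_one_or hij with h1 | h1
  · rw [addLegendreSym_of_eq_one h1]
    have : d.neg i j = false := by
      cases hu : d.neg i j
      · rfl
      · exact absurd (hiff.mpr hu) (by rw [h1]; decide)
    simp [this, bz]
  · rw [addLegendreSym_of_eq_neg_one h1, hiff.mp h1]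
    rfl

/-- The diagonal of Monsky's `A` is the row parity of the data. -/
theorem Matches.sum_addLegendreSym_eq (hM : Matches P d) (i : Fin k) :
    ∑ l ∈ Finset.univ.erase i, addLegendreSym (P l : ℤ) (P i) =
      bz (xorFold ((List.finRange k).filter (fun l => l ≠ i)) (d.neg i)) := by
  calc ∑ l ∈ Finset.univ.erase i, addLegendreSym (P l : ℤ) (P i)
      = ∑ l ∈ Finset.univ.erase i, bz (d.neg i l) :=
        Finset.sum_congr rfl fun l hl => hM.addLegendreSym_eq (Finset.ne_of_mem_erase hl).symm
    _ = ∑ l, if l ≠ i then bz (d.neg i l) else 0 := by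
        rw [← Finset.sum_filter, Finset.filter_ne']
    _ = ∑ l, bz (decide (l ≠ i) && d.neg i l) := by simp only [bz_decide_and]
    _ = bz (xorFold (List.finRange k) (fun l => decide (l ≠ i) && d.neg i l)) := sum_univ_bz k _
    _ = bz (xorFold ((List.finRange k).filter (fun l => l ≠ i)) (d.neg i)) := by rw [xorFold_filter]

/-- `D₂` entries from the classes: `[(2/P_i) = −1]`. -/
theorem Matches.addLegendreSym_two (hM : Matches P d) (i : Fin k) :
    addLegendreSym 2 (P i) = bz (negTwo (d.cls i)) := by
  have h8 := hM.mod_eight i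
  have hmem := clsVal_mem (d.cls i)
  rw [negTwo_eq]
  by_cases hc : clsVal (d.cls i) = 3 ∨ clsVal (d.cls i) = 5
  · rw [decide_eq_true hc, addLegendreSym_of_eq_neg_one (jacobiSym_two_eq_neg_one (by omega))]; rfl
  · rw [decide_eq_false hc, addLegendreSym_of_eq_one (jacobiSym_two_eq_one (by omega))]; rfl

/-- `D₋₁` entries from the classes: `[(−1/P_i) = −1]`. -/
theorem Matches.addLegendreSym_neg_one (hM : Matches P d) (i : Fin k) :
    addLegendreSym (-1) (P i) = bz (negNegOne (d.cls i)) := by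
  have h8 := hM.mod_eight i
  have hmem := clsVal_mem (d.cls i)
  rw [negNegOne_eq]
  by_cases hc : clsVal (d.cls i) = 3 ∨ clsVal (d.cls i) = 7
  · rw [decide_eq_true hc, addLegendreSym_of_eq_neg_one (DeuringLadic.jacobiSym_neg_one_of_mod_four (by omega))]
    rfl
  · rw [decide_eq_false hc, addLegendreSym_of_eq_one (jacobiSym_neg_one_eq_one (by omega))]; rfl

/-- `D₋₂` entries from the classes: `[(−2/P_i) = −1]`. -/
theorem Matches.addLegendreSym_neg_two (hM : Matches P d) (i : Fin k) :
    addLegendreSym (-2) (P i) = bz (negNegTwo (d.cls i)) := by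
  have h8 := hM.mod_eight i
  have hmem := clsVal_mem (d.cls i)
  rw [negNegTwo_eq]
  by_cases hc : clsVal (d.cls i) = 5 ∨ clsVal (d.cls i) = 7
  · rw [decide_eq_true hc, addLegendreSym_of_eq_neg_one (jacobiSym_neg_two_eq_neg_one (by omega))]; rfl
  · rw [decide_eq_false hc, addLegendreSym_of_eq_one (jacobiSym_neg_two_eq_one (by omega))]; rfl

/-- Monsky's `A` of realising primes is the symbolic `A`. -/
theorem Matches.legendreMatrix_apply (hM : Matches P d) (i j : Fin k) :
    legendreMatrix P i j = bz (d.aEntry i j) := by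
  rw [legendreMatrix, Matrix.of_apply, SymbData.aEntry]
  by_cases hij : i = j
  · subst hij
    rw [if_pos rfl, if_pos rfl, hM.sum_addLegendreSym_eq]
  · rw [if_neg hij, if_neg hij, hM.addLegendreSym_eq hij]

/-- **Transport, odd case**: primes realising the symbol data have Monsky matrix `monskyOddS`. -/
theorem Matches.monskyMatrixOdd_eq (hM : Matches P d) : monskyMatrixOdd P = d.monskyOddS := by
  ext x y
  rcases x with i | i <;> rcases y with j | j <;>
    simp only [monskyMatrixOdd, Matrix.fromBlocks_apply₁₁, Matrix.fromBlocks_apply₁₂, Matrix.fromBlocks_apply₂₁,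
      Matrix.fromBlocks_apply₂₂, Matrix.add_apply, legendreDiagonal, Matrix.diagonal_apply, hM.legendreMatrix_apply,
      SymbData.monskyOddS, Matrix.of_apply, SymbData.entryOdd, bz_xor, bz_decide_and] <;>
    split_ifs <;> simp [hM.addLegendreSym_two, hM.addLegendreSym_neg_two]

/-- **Transport, even case**: primes realising the symbol data have Monsky matrix `monskyEvenS`. -/
theorem Matches.monskyMatrixEven_eq (hM : Matches P d) : monskyMatrixEven P = d.monskyEvenS := by
  ext x y
  rcases x with i | i <;> rcases y with j | j <;>
    simp only [monskyMatrixEven, Matrix.fromBlocks_apply₁₁, Matrix.fromBlocks_apply₁₂, Matrix.fromBlocks_apply₂₁,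
      Matrix.fromBlocks_apply₂₂, Matrix.add_apply, Matrix.transpose_apply, legendreDiagonal, Matrix.diagonal_apply,
      hM.legendreMatrix_apply, SymbData.monskyEvenS, Matrix.of_apply, SymbData.entryEven, bz_xor, bz_decide_and] <;>
    split_ifs <;> simp [hM.addLegendreSym_two, hM.addLegendreSym_neg_one]

/-- **Door, odd**: primes realising symbol data whose `detCheckOdd` accepts have `det M_odd = 1` (`s = 0`). -/
theorem Matches.det_monskyMatrixOdd_eq_one (hM : Matches P d) (h : d.detCheckOdd = true) :
    (monskyMatrixOdd P).det = 1 := by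
  rw [hM.monskyMatrixOdd_eq]
  exact d.det_monskyOddS_eq_one h

/-- **Door, even**: primes realising symbol data whose `detCheckEven` accepts have `det M_even = 1` (`s = 0`). -/
theorem Matches.det_monskyMatrixEven_eq_one (hM : Matches P d) (h : d.detCheckEven = true) :
    (monskyMatrixEven P).det = 1 := by
  rw [hM.monskyMatrixEven_eq]
  exact d.det_monskyEvenS_eq_one h

end Transport

end Summit.BirchSwinnertonDyer.BirchSwinnertonDyer.Theorems.SymbolicMonsky
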